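/-
Copyright (c) 2026 the pub-hodgecm-mathlib formalisation cell (harness21).  Prover seat hodgecm-mathlib-K2E3-p23 (g7), routed to R90 section S2
(S2 dealer K2E1b-plan (g7), deal «S2-pin18» 2026-09-04T16:53:27Z): PIN #18 — on the cohomological locus the non-tempered member of the archimedean
packet of record IS the `J`-carrier of record, `(archPacketAt jInfOfRecord dsInfOfRecord p q t).πn = jInfOfRecord p q t`.
-/
import Summits.HodgeConjecture.HodgeConjecture.Theorems.K2E1bClassEqArchDegOneOfPType   -- ★ #18 (K2E1b-p16): `exists_cochain_type_one`, `exists_cochain_type_neg_one` (+ ★ `F0P3bArchDegOneClass`, Upq cohomology API)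
import Summits.HodgeConjecture.HodgeConjecture.Theorems.K2E1bCarriersOfRecord            -- ★ #23: `jRepOfRecord`, `jInfOfRecord`, `dsInfOfRecord`, `jRepOfRecord_package`, `actsOnKTypes_of_twist_zero`, …
import Summits.HodgeConjecture.HodgeConjecture.Theorems.F0P3XiArchPacketOfRecord          -- ★ K6: `archPacketAt`, `archPacketAt_πn_of`
import HarnessLib

/-!
# R90 ∕ S2 «archimedean packets», PIN #18: `πⁿ(ξ_∞)` OF THE PACKET OF RECORD IS THE `J`-CARRIER OF RECORD ON THE COHOMOLOGICAL LOCUS —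
# `archPacketAt_πn_eq_jInfOfRecord (h : IsCohTrivial p q t) : (archPacketAt jInfOfRecord dsInfOfRecord p q t).πn = jInfOfRecord p q t`

Cell `pub/hodgecm-mathlib` (D-0151), crux H413 = `stmt-HodgeConjecture-24833` (`--supports … --as helper`; closes nothing by itself).  Deal «S2-pin18»
of the S2 dealer K2E1b-plan (g7): the Level-B hypothesis of `Cruxes/H413/Lines/R90_S2_ArchPacketsTopC`'s `datum_prop1233b_ofRecord_of_pin` and the core
of the (β) recognition hand.  THEOREMS ONLY (no definition ∕ instance ∕ notation ∕ named fact ∕ `sorry`); imports ★ Theorems only (never `Cruxes/…/Lines`).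

THE STATEMENT.  ★ `archPacketAt jInf dsInf p q t` (K6) names `πⁿ := archDegOneClass (rogSign p t)` (the CLASS OF RECORD `[J^{±}]`, ★ X1′) ON the
cohomological locus ★ `ArchSignRecipe.IsCohTrivial p q t` (`φ = φ(1,0,−1)`) and `πⁿ := jInf p q t` off it.  With the DEFINED carriers ★ #23
`jInfOfRecord ∕ dsInfOfRecord` (Kovačević ladder ∕ wall rays of record, twisted by `e(φ) = centralExp p q t`), PIN #18 says the two names agree on the
locus: `[J^{rogSign p t}] = jInfOfRecord p q t`.

THE PROOF (EXIT 2 rigidity, in-house).  On the locus (★ `isCohTrivial_iff`: `(q, s) = (1, −2)` or `(−1, 1)`, `s = p + t`; ★ `rogSign_eq_of_isCohTrivial`: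
`rogSign p t = q`) the `J`-structure of record is the LADDER ray `rayNE (−3) 2 = Z(3)` (`q = 1`; lowest `K`-type `(2, 3) = 𝔭⁺`) resp. `raySE (−3) 2 = Z(−3)`
(`q = −1`; lowest `K`-type `(2, −3) = 𝔭⁻`) — SIGN ↔ RAY: the `𝔭`-type of the record `J`-carrier on the locus is `(2, 3q)`; the central twist vanishes
(★ `centralExp_eq_zero_of_isCohTrivial`, so the `𝔨`-action is Kovačević's untwisted one, ★ `actsOnKTypes_of_twist_zero`) and so does the Casimir exponent
(`casimirExp = 1 + 0 + 1 − 2 = 0`, §1; ★ `jRepOfRecord_package` gives `upqCasimirOp = 0` and `IsCohUnitaryIrrep`).  ★ #18 `K2E1bClassEqArchDegOneOfPType` §B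
supplies a non-zero relative 1-cochain of type `+1` from the `𝔭`-type `(2,3)` (resp. `−1` from `(2,−3)`); Casimir `0` + unitarity along `𝔭` make every cochain
closed and `C¹ ≅ H¹` (★ `upq_d_eq_zero_of_casimir_eq_zero`, ★ `upqClassMap_bijective`, BW II Cor. 3.3), so `H¹_{rogSign p t} ≠ 0` on the record `J`-carrier
(§2–§3 = ★ #18's `key` step, re-run with the SIGN kept), and EXIT 2 rigidity ★ `ofModule_eq_archDegOneClass` (one class per type, BW VI Thm. 4.11 ∕
Rogawski Prop. 15.2.1 (b)) identifies the class (§4).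
[Rogawski1990, §12.3 p. 178, Prop. 15.2.1 (b) p. 249] [BorelWallach2000, II Prop. 3.1, Cor. 3.3; VI Thm. 4.11] [Kovacevic2021, §3 Def. 1, §4 Thm. 4–5, §6].
HONEST LABEL: HC_CM is proved only modulo the 7 printed citations (2 remaining named inputs: hLiu418 = stmt-HodgeConjecture-24832, h413 =
stmt-HodgeConjecture-24833) until rung 0 closes; a Level-B pin on the DEFINED carriers of record, count-neutral.

## References
* [Rogawski1990] J. Rogawski, *Automorphic Representations of Unitary Groups in Three Variables*, Annals of Math. Studies 123 (1990), §12.3 p. 178; Prop. 15.2.1 (b) p. 249.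
* [BorelWallach2000] A. Borel, N. Wallach, *Continuous Cohomology, Discrete Subgroups, and Representations of Reductive Groups*, 2nd ed. (2000),
  II Prop. 3.1, Cor. 3.3; VI Thm. 4.11.
* [Kovacevic2021] D. Kovačević, *Classification of irreducible unitary `(𝔤,K)`-modules of `SU(2,1)` via `K`-types* (2021), §3 Def. 1, §4 Thm. 4–5, §6.
-/

set_option autoImplicit false
set_option linter.dupNamespace false

noncomputable section

open Literature.Algebra.Lie Literature.Algebra.Lie.ChevalleyEilenberg
open Literature.NumberTheory.Automorphic Literature.NumberTheory.Rogawski1990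
open Literature.RepresentationTheory
open Literature.RepresentationTheory.BorelWallach2000
open Literature.RepresentationTheory.KonnoKonno2007 Literature.RepresentationTheory.KonnoKonno2007.RealDualPair
open Literature.RepresentationTheory.KonnoKonno2007.RealDualPair.UForm
open Literature.RepresentationTheory.Kovacevic2021 Literature.RepresentationTheory.Kovacevic2021.SU21Datum
open Summit.HodgeConjecture.HodgeConjecture.Cruxes.H413.F0P3bLocalAPacketsDefs (G21)
open Summit.HodgeConjecture.HodgeConjecture.Cruxes.H413.F0P3bArchDegOnePackage (IsCohUnitaryIrrep)
open Summit.HodgeConjecture.HodgeConjecture.Cruxes.H413.F0P3bArchDegOneClass (archDegOneClass ofModule_eq_archDegOneClass)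
open Summit.HodgeConjecture.HodgeConjecture.Cruxes.H413.F0P3bKTypeIntegration (KIdx kvec ActsOnKTypes)
open Summit.HodgeConjecture.HodgeConjecture.Cruxes.H413.F0P3XiArchPacketOfRecord (archPacketAt archPacketAt_πn_of)
open Summit.HodgeConjecture.HodgeConjecture.Cruxes.H413.K2E1bGKCohomologyU21 (centralExp casimirExp)
open Summit.HodgeConjecture.HodgeConjecture.Cruxes.H413.K2E1bCarriersOfRecord
open Summit.HodgeConjecture.HodgeConjecture.Cruxes.H413.K2E1bClassEqArchDegOneOfPType (exists_cochain_type_one exists_cochain_type_neg_one)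

namespace Summit.HodgeConjecture.HodgeConjecture.R90.S2

/-! ## §1 The locus: the Casimir exponent vanishes -/

/-- On the cohomological locus the Casimir exponent vanishes: `rogTriple p q t = (1, 0, −1) ⇒ casimirExp p q t = 1 + 0 + 1 − 2 = 0` (twin of ★
`centralExp_eq_zero_of_isCohTrivial`). [cite: Rogawski1990, §12.3 p. 178] -/
theorem casimirExp_eq_zero_of_isCohTrivial {p q t : ℤ} (h : ArchSignRecipe.IsCohTrivial p q t) : casimirExp p q t = 0 := by
  unfold ArchSignRecipe.IsCohTrivial at h
  simp only [casimirExp, h]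
  norm_num

/-! ## §2 `C¹ ≅ H¹` under Casimir `0`: a non-zero cochain of type `δ` gives `H¹_δ ≠ 0` (★ #18's `key` step, sign kept) -/

/-- **A non-zero relative 1-cochain of type `δ` gives a non-zero class in `H¹_δ`** on a bundled irreducible `(𝔲(2,1), K)`-module (★ `GKIrrep`) that is
unitary cohomological with Casimir `0`: unitarity along `𝔭` and Casimir `0` force `d = 0` on `C^•(𝔤, K; V)` (★ `upq_d_eq_zero_of_casimir_eq_zero`), so `C¹ ≅ H¹`
(★ `upqClassMap_bijective`) and the class of `f` lies in `upqTypeClasses … 1 δ` (★ `mem_upqTypeClasses_iff`) and is non-zero.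
[cite: BorelWallach2000, II Prop. 3.1, Cor. 3.3] -/
theorem upqTypeClasses_ne_bot_of_cochain (r : GKIrrep G21) (h : IsCohUnitaryIrrep r.ρK r.ρ𝔤)
    (hC : ∀ v : r.V, upqCasimirOp r.ρ𝔤 v = 0) (δ : ℤ) (f : Cochain ℝ G21.lie (GKCarrier G21 r.ρ𝔤) 1)
    (hft : f ∈ upqType r.ρK r.ρ𝔤 h.gk.ad_compat 1 δ) (hf0 : f ≠ 0) :
    upqTypeClasses r.ρK r.ρ𝔤 h.gk.ad_compat 1 δ ≠ ⊥ := by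
  -- Casimir `0` + unitarity along `𝔭` ⇒ `d = 0` on `C^•(𝔲(2,1), K; V)`
  obtain ⟨B, hBs, hB, hBd, hadj, -, -⟩ := h.unit
  have hc : ∀ v : r.V, upqCasimirOp r.ρ𝔤 v = (0 : ℂ) • v := fun v => by rw [hC v, zero_smul]
  have hd := upq_d_eq_zero_of_casimir_eq_zero r.ρK r.ρ𝔤 h.gk.ad_compat hBs hB hBd upq_casimir_hspan
    upq_lie_upqPBasis_mem_kInLie hadj upqKDual_mem upq_casimirTensor_lie_invariant hc rfl
  have hfc := ((mem_upqType_iff r.ρK r.ρ𝔤 h.gk.ad_compat 1 δ f).1 hft).1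
  rw [Submodule.ne_bot_iff]
  refine ⟨upqClassMap r.ρK r.ρ𝔤 h.gk.ad_compat hd 1 ⟨f, hfc⟩,
    (mem_upqTypeClasses_iff r.ρK r.ρ𝔤 h.gk.ad_compat hd 1 δ _).2 ⟨⟨f, hfc⟩, hft, rfl⟩, fun h0 => hf0 ?_⟩
  have h00 : (⟨f, hfc⟩ : (gkComplex G21 r.ρK r.ρ𝔤 h.gk.ad_compat).carrier 1) = 0 :=
    (upqClassMap_bijective r.ρK r.ρ𝔤 h.gk.ad_compat hd 1).1 (by rw [h0, map_zero])
  exact congrArg Subtype.val h00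

/-! ## §3 The heart: `H¹_{rogSign p t} ≠ 0` on the `J`-carrier of record, on the locus -/

/-- **The record `J`-carrier on the locus has a non-zero degree-one class of type `rogSign p t`.**  On the locus `rogSign p t = q = ±1`, `s = p + t = −2`
resp. `1`, the central twist and the Casimir exponent vanish, and the structure of record is the ladder ray `rayNE (−3) 2` (lowest `K`-type `(2, 3) = 𝔭⁺`,
type `+1`) resp. `raySE (−3) 2` (lowest `K`-type `(2, −3) = 𝔭⁻`, type `−1`): ★ #18 §B gives the non-zero cochain of that type, §2 the non-zero class.
[cite: Rogawski1990, §12.3 p. 178, Prop. 15.2.1 (b)] [cite: BorelWallach2000, II Cor. 3.3; VI Thm. 4.11] [cite: Kovacevic2021, §4 Thm. 4–5, §6] -/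
theorem upqTypeClasses_jRepOfRecord_ne_bot {p q t : ℤ} (h : ArchSignRecipe.IsCohTrivial p q t) :
    upqTypeClasses (jRepOfRecord p q t).ρK (jRepOfRecord p q t).ρ𝔤 (jRepOfRecord_package p q t).1.gk.ad_compat 1 (ArchSignRecipe.rogSign p t) ≠ ⊥ := by
  have hcoh : IsCohUnitaryIrrep (jRepOfRecord p q t).ρK (jRepOfRecord p q t).ρ𝔤 := (jRepOfRecord_package p q t).1
  -- on the locus: central twist `0` (untwisted `𝔨`-action) and Casimir `0`
  have he : ((centralExp p q t : ℤ) : ℂ) = 0 := by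
    rw [centralExp_eq_zero_of_isCohTrivial h, Int.cast_zero]
  have hacts : ActsOnKTypes (jDatumOfRecord (p + t)).S (jRepOfRecord p q t).ρ𝔤 :=
    actsOnKTypes_of_twist_zero he (actsOnKTypesTwist_ofRecord (jDatumOfRecord (p + t)) (centralExp p q t))
  have hC : ∀ v : (jRepOfRecord p q t).V, upqCasimirOp (jRepOfRecord p q t).ρ𝔤 v = 0 := fun v => by
    rw [(jRepOfRecord_package p q t).2.1 v, casimirExp_eq_zero_of_isCohTrivial h, Int.cast_zero, zero_smul]
  rw [ArchSignRecipe.rogSign_eq_of_isCohTrivial h]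
  rcases (ArchSignRecipe.isCohTrivial_iff p q t).1 h with ⟨hq, hs⟩ | ⟨hq, hs⟩
  · -- `q = 1`, `s = −2`: the north-east ladder ray from `(2, 3) = 𝔭⁺`
    subst hq
    have hS : ((2 : ℤ), (3 : ℤ)) ∈ (jDatumOfRecord (p + t)).S := by
      rw [jDatumOfRecord_of_le (show p + t ≤ -1 by omega)]
      exact ⟨show -(p + t) ≤ 2 by omega, show (3 : ℤ) = 3 * 2 + (2 * (p + t) + 1) by omega⟩
    obtain ⟨f, hft, hf0⟩ := exists_cochain_type_one hcoh.gk hacts hS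
    exact upqTypeClasses_ne_bot_of_cochain _ hcoh hC 1 f hft hf0
  · -- `q = −1`, `s = 1`: the south-east ladder ray from `(2, −3) = 𝔭⁻`
    subst hq
    have hS : ((2 : ℤ), (-3 : ℤ)) ∈ (jDatumOfRecord (p + t)).S := by
      rw [jDatumOfRecord_of_not_le (show ¬ p + t ≤ -1 by omega)]
      exact ⟨show p + t + 1 ≤ 2 by omega, show (-3 : ℤ) = -(3 * 2 + -(2 * (p + t) + 1)) by omega⟩
    obtain ⟨f, hft, hf0⟩ := exists_cochain_type_neg_one hcoh.gk hacts hS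
    exact upqTypeClasses_ne_bot_of_cochain _ hcoh hC (-1) f hft hf0

/-! ## §4 PIN #18 -/

/-- **PIN #18 — `πⁿ(ξ_∞)` OF THE PACKET OF RECORD IS THE `J`-CARRIER OF RECORD ON THE COHOMOLOGICAL LOCUS**:
`(archPacketAt jInfOfRecord dsInfOfRecord p q t).πn = jInfOfRecord p q t` whenever `IsCohTrivial p q t`.  ★ `archPacketAt_πn_of` names `πⁿ` as the class
of record `archDegOneClass (rogSign p t)`; `jInfOfRecord p q t` is the class of the bundled record `J`-carrier (★ `GKIrrClass.ofModule` of its own data, by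
structure eta); EXIT 2 rigidity ★ `ofModule_eq_archDegOneClass` with the non-zero `H¹_{rogSign p t}` of §3 identifies the two.
[cite: Rogawski1990, §12.3 p. 178, Prop. 15.2.1 (b) p. 249] [cite: BorelWallach2000, VI Thm. 4.11] -/
theorem archPacketAt_πn_eq_jInfOfRecord {p q t : ℤ} (h : ArchSignRecipe.IsCohTrivial p q t) :
    (archPacketAt jInfOfRecord dsInfOfRecord p q t).πn = jInfOfRecord p q t := by
  have hcoh : IsCohUnitaryIrrep (jRepOfRecord p q t).ρK (jRepOfRecord p q t).ρ𝔤 := (jRepOfRecord_package p q t).1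
  have hj : GKIrrClass.ofModule (jRepOfRecord p q t).V (jRepOfRecord p q t).ρK (jRepOfRecord p q t).ρ𝔤 hcoh.gk hcoh.irred =
      jInfOfRecord p q t := rfl
  rw [archPacketAt_πn_of jInfOfRecord dsInfOfRecord h, ← hj]
  exact (ofModule_eq_archDegOneClass _ _ hcoh (ArchSignRecipe.rogSign p t) (ArchSignRecipe.rogSign_eq_one_or_eq_neg_one p t)
    (upqTypeClasses_jRepOfRecord_ne_bot h)).symm

end Summit.HodgeConjecture.HodgeConjecture.R90.S2

end
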